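/-
Copyright (c) 2026. Released under Apache 2.0 license.
-/
import Summits.RiemannHypothesis.RiemannHypothesis.Theorems.MotivicDoorSemilocalUndecicKernelA
import HarnessLib

/-!
# Motivic door, semi-local ladder — kernel-checked numerics for the degree-11 certificate (part B)

Pub speedrun, cell `pub-rhdoor`, seat `lad-2`, generation 5 (KERNEL file B of rung R3⁻(0.57));
continuation of `MotivicDoorSemilocalUndecicKernelA.lean`.

* `checkChunkU_4/5/6` + `bulkB_le`: blocks `i = 1141 … 1520`, `1521 … 1900`, `1901 … 2279` of the
  upper Riemann sum;
* `hornerR_dU_log_two_le`: `Δ(log 2 / b) ≤ BUD / 2^48`, `b = 0.57` (`Δ(τ*) = 1202035.6…`);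
* `tailTU_le`: `2e^{-b} + (2/5)e^{-5b} + (2/9)e^{-9b}/(1 - e^{-4b}) ≤ BUT / 2^48` (`= 1.155653…`).

PROVED: everything (sorry-free; `decide +kernel`, no `native_decide`).
-/

set_option linter.dupNamespace false

noncomputable section

open Real Finset
open Literature.Analysis.ValidatedNumerics.Numerics

namespace Summit.RiemannHypothesis.RiemannHypothesis.Theorems.MotivicDoor.SemilocalUndecicKernel

open SemilocalKernel SemilocalUndecic

/-! ## Blocks 4–6 (kernel evaluation) -/

/-- Scaled upper bound of block 4 (`i = 1141 … 1520`). -/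
def BU4 : ℤ := 110123173208126895983
/-- Scaled upper bound of block 5 (`i = 1521 … 1900`). -/
def BU5 : ℤ := 138519936993252172130
/-- Scaled upper bound of block 6 (`i = 1901 … 2279`). -/
def BU6 : ℤ := 104813064615864085805

set_option maxHeartbeats 0 in
/-- Block 4 passes. -/
theorem checkChunkU_4 : gcheckChunk iU 1140 1141 380 BU4 = true := by
  decide +kernel

set_option maxHeartbeats 0 in
/-- Block 5 passes. -/
theorem checkChunkU_5 : gcheckChunk iU 1140 1521 380 BU5 = true := by
  decide +kernel

set_option maxHeartbeats 0 in
/-- Block 6 passes. -/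
theorem checkChunkU_6 : gcheckChunk iU 1140 1901 379 BU6 = true := by
  decide +kernel

/-- Blocks 4–6: `Σ_{i=1141}^{2279} ≤ (BU4 + BU5 + BU6) / 2^48`. -/
theorem bulkB_le :
    gchunkR iU 1140 1141 380 + gchunkR iU 1140 1521 380 + gchunkR iU 1140 1901 379
      ≤ ((BU4 + BU5 + BU6 : ℤ) : ℝ) / SC := by
  have hd : 0 < 1140 := by norm_num
  have h1 := gchunkR_le_of_check hd checkChunkU_4
  have h2 := gchunkR_le_of_check hd checkChunkU_5
  have h3 := gchunkR_le_of_check hd checkChunkU_6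
  push_cast at h1 h2 h3 ⊢
  have := SC_pos
  rw [add_div, add_div]
  linarith

/-! ## `Δ(log 2 / b)` -/

/-- Interval for `τ* = log 2 / 0.57` from `0.6931471803 < log 2 < 0.6931471808`. -/
def tauStarU : FI := ⟨342286993740349, 342286993987258⟩

/-- `log 2 / b ∈ tauStarU`. -/
theorem mem_tauStarU : FI.mem (Real.log 2 / (57 / 100)) tauStarU := by
  have h1 := Real.log_two_gt_d9
  have h2 := Real.log_two_lt_d9
  rw [FI.mem_def, tauStarU, SC]
  push_cast
  constructor <;> nlinarith

/-- Scaled upper bound for `Δ(τ*)` (`Δ(τ*) = 1202035.63…`). -/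
def BUD : ℤ := 338341650978325849205

set_option maxHeartbeats 0 in
/-- The `Δ(τ*)` check passes. -/
theorem checkDU : decide ((hornerFI dU tauStarU).hi ≤ BUD) = true := by
  decide +kernel

/-- `Δ(log 2 / b) ≤ BUD / 2^48`. -/
theorem hornerR_dU_log_two_le : hornerR dU (Real.log 2 / (57 / 100)) ≤ (BUD : ℝ) / SC := by
  have hm := mem_hornerFI mem_tauStarU dU
  refine (FI.le_hi_div hm).trans ?_
  exact div_le_div_of_nonneg_right (by exact_mod_cast of_decide_eq_true checkDU) SC_pos.le

/-! ## The tail constant at `b = 0.57` -/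

/-- Enclosure of `T(e^{-0.57})`, `T(e) = 2e + (2/5)e⁵ + (2/9)e⁹/(1 - e⁴)`. -/
def tailFIU : Option FI :=
  match FI.expSmall (FI.ofFrac (-57) 100) with
  | none => none
  | some E =>
    let E4 := FI.sqr (FI.sqr E)
    match FI.divPos ((ofRat (2 / 9)).mul (E.mul (FI.sqr E4))) ((FI.ofInt 1).sub E4) with
    | none => none
    | some Q => some (((ofRat 2).mul E).add (((ofRat (2 / 5)).mul (E.mul E4)).add Q))

/-- Scaled upper bound for the tail constant (`T = 1.1556539…`). -/
def BUT : ℤ := 325287458194651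

/-- The tail check. -/
def checkTU : Bool := match tailFIU with | some T => decide (T.hi ≤ BUT) | none => false

set_option maxHeartbeats 0 in
/-- The tail check passes. -/
theorem checkTU_true : checkTU = true := by
  decide +kernel

/-- `T(e^{-b}) ≤ BUT / 2^48`, `b = 0.57`. -/
theorem tailTU_le : tailT (Real.exp (-(57 / 100))) ≤ (BUT : ℝ) / SC := by
  have h := checkTU_true
  unfold checkTU at h
  split at h
  · rename_i T hT
    have hB : T.hi ≤ BUT := of_decide_eq_true h
    suffices hm : FI.mem (tailT (Real.exp (-(57 / 100)))) T by
      refine (FI.le_hi_div hm).trans ?_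
      exact div_le_div_of_nonneg_right (by exact_mod_cast hB) SC_pos.le
    unfold tailFIU at hT
    split at hT
    · exact absurd hT (by simp)
    · rename_i E hE
      have hx : FI.mem (-(57 / 100 : ℝ)) (FI.ofFrac (-57) 100) := by
        have := FI.mem_ofFrac (-57) (q := 100) (by norm_num)
        convert this using 1; push_cast; ring
      have he := FI.mem_expSmall hE hx
      set e := Real.exp (-(57 / 100 : ℝ))
      have h4 : FI.mem (e ^ 4) (FI.sqr (FI.sqr E)) := by
        rw [show (4 : ℕ) = 2 * 2 by norm_num, pow_mul]; exact FI.mem_sqr (FI.mem_sqr he)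
      simp only at hT
      split at hT
      · exact absurd hT (by simp)
      · rename_i Q hQ
        rw [Option.some.injEq] at hT
        subst hT
        have hq := FI.mem_divPos hQ
          (FI.mem_mul (mem_ofRat (2 / 9)) (FI.mem_mul he (FI.mem_sqr h4)))
          (FI.mem_sub mem_one h4)
        have := FI.mem_add (FI.mem_mul (mem_ofRat 2) he)
          (FI.mem_add (FI.mem_mul (mem_ofRat (2 / 5)) (FI.mem_mul he h4)) hq)
        convert this using 1
        simp only [tailT]; push_cast; ring
  · exact absurd h (by simp)

end Summit.RiemannHypothesis.RiemannHypothesis.Theorems.MotivicDoor.SemilocalUndecicKernel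

end
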